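import Literature.AlgebraicGeometry.Motives.JacobianBrillNoetherLocusDimensionCharZero
import Literature.AlgebraicGeometry.Motives.WeilJacobianStepOneOpen
import HarnessLib

/-!
# The dense open of Step I for an ABSTRACT Jacobian over any algebraically closed field of characteristic zero:
# general points of `J` are `g`-fold Abel sums of `g` distinct points, unique up to order

Layer `Literature/AlgebraicGeometry/Motives`, namespace `Literature.AlgebraicGeometry.Motives.Jacobian`.  KERNEL ONLY (theorems; no definition,
no named fact, no instance, no `sorry`).

★ `Motives/JacobianStepOneOpenTransport` (`Jacobian.exists_opens_general_abelSum_of_isSmoothProjective`, the socket `hopen` of the road-G4 ∕ VI-8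
programme of cell `hodgecm-mathlib`) produces the Step-I open for an abstract Jacobian of a smooth projective COMPLEX curve, the existence half resting on
the dimension count `dim J = g` over `ℂ` (Hodge theory).  ★ `Motives/WeilJacobianStepOneOpen` (`WeilJacobian.exists_opens_general_sum`) has it for WEIL'S
model over any algebraically closed field of characteristic `0`.  Here: the same statement for EVERY Jacobian `𝒥 : Jacobian C` (universal property) of a
smooth projective geometrically integral curve `C` of genus `g ≥ 1` over ANY algebraically closed field `K` of characteristic `0`, by Weil's own argument
run directly on `𝒥` — the Abel sum `α_g : Cᵍ → J` is ONTO `J(K)` (★ `Jacobian.exists_tuple_prod_comp_abelJacobi_eq_of_curveGenus_le`, from `W̃_g(P) = J`,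
`Motives/JacobianBrillNoetherLocusDimensionCharZero`), its fibres over the `ℓ = 1` locus are `𝔖_g`-orbits (★ `Jacobian.exists_perm_of_prod_comp_abelJacobi_eq_of_ell_eq_one`),
and the good locus `V ⊆ Cᵍ` (general locus off the big diagonals) is a non-empty open whose image avoids `α_g(Cᵍ ∖ V)` (closed-point specialisation in
the Jacobson space `Cᵍ`):

* **`Jacobian.exists_opens_general_abelSum_of_isAlgClosed`** — a non-empty open `U₁ ⊆ J` such that every `a ∈ J(K)` with `a.pt ∈ U₁` is `∏ⱼ α_P(τⱼ)`
  for an INJECTIVE `τ : Fin g → C(K)`, unique up to a permutation (Milne JV Lemma 6.7 ∕ Lange Lemma 4.4.4 Step I), `g = curveGenus C`.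

Use (cell `hodgecm-mathlib`, D-0151; crux HLiu418 = stmt-HodgeConjecture-24832; field-general form of the (γ) socket).  COUNT-NEUTRAL.
HC_CM is proved only modulo the 7 printed citations until rung 0 closes; this file moves no book by itself.

## References
* [Milne1986JacobianVarieties] J. S. Milne, *Jacobian Varieties* (1986), §5 Thm. 5.1 (a), §6 Lemma 6.7 (p. 187).
* [Lange2023AbelianVarietiesComplex] H. Lange, *Abelian Varieties over the Complex Numbers* (2023), §4.4.2 Lemma 4.4.4 (Step I).
* [GortzWedhorn2020] U. Görtz, T. Wedhorn, *Algebraic Geometry I*, 2nd ed. (2020), Prop. 12.58 (p. 349), Cor. 3.36 (p. 83).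
-/

set_option autoImplicit false

noncomputable section

universe u

open CategoryTheory CategoryTheory.Limits AlgebraicGeometry MonoidalCategory CartesianMonoidalCategory TopologicalSpace
open Literature.NumberTheory.DiophantineGeometry Literature.NumberTheory.DiophantineGeometry.AlgFunctionField
open Literature.AlgebraicGeometry.RelativeSpec

namespace Literature.AlgebraicGeometry.Motives

namespace Jacobian

open RatFn FieldPoint CartierDivisor CurvePlaces

variable {K : Type u} [Field K] [IsAlgClosed K] [CharZero K] {C : SchemeOver K} [IsIntegral C.left]
  [SmoothOfRelativeDimension 1 C.hom] [IsProper C.hom] [GeometricallyIntegral C.hom]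

/-- **THE DENSE OPEN OF STEP I for an abstract Jacobian, any algebraically closed field of characteristic `0`.**  For a smooth projective geometrically
integral curve `C` of genus `g ≥ 1`, every Jacobian `𝒥` of `C` and every base point `P ∈ C(K)`: there is a non-empty open `U₁ ⊆ J` such that every
`K`-point `a` of `U₁` is `∏ⱼ α_P(τⱼ)` for a tuple `τ` of `g` PAIRWISE DISTINCT points, UNIQUE up to a permutation among all tuples with that Abel sum.
`U₁ := J ∖ α_g(Cᵍ ∖ V)` with `V` = general locus (`ℓ(Σ τⱼ) = 1`, ★ `isOpen_generalLocus`, non-empty ★ `nonempty_generalLocus_of_le`) off the big diagonals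
(images of the proper diagonal maps `δ_{ij}`); `α_g` is proper hence closed, onto `J(K)` (★ `exists_tuple_prod_comp_abelJacobi_eq_of_curveGenus_le`), with
`𝔖_g`-orbits as fibres over `V` (★ `exists_perm_of_prod_comp_abelJacobi_eq_of_ell_eq_one`); `U₁ ∋ α_g(ω₀)` for `ω₀ ∈ V(K)` because a point of `Cᵍ ∖ V`
over `α_g(ω₀)` specialises to a closed one, a permutation of `ω₀`.  (Word for word ★ `WeilJacobian.exists_opens_general_sum`, run on `𝒥` instead of Weil's
`Jac`; ★ `exists_opens_general_abelSum_of_isSmoothProjective` is the complex case.)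
[cite: Milne1986JacobianVarieties, §6 Lemma 6.7 (p. 187) and §5 Thm. 5.1 (a)] [cite: Lange2023AbelianVarietiesComplex, §4.4.2 Lemma 4.4.4 (Step I)]
[cite: GortzWedhorn2020, Prop. 12.58 (p. 349)] -/
theorem exists_opens_general_abelSum_of_isAlgClosed (hC : IsProjectiveOver C) (hpos : 1 ≤ curveGenus C) (𝒥 : Jacobian C)
    (P : AlgPoints C K) :
    ∃ U₁ : 𝒥.J.X.left.Opens, (U₁ : Set 𝒥.J.X.left).Nonempty ∧
      ∀ a : 𝒥.J.Points K, a.pt ∈ U₁ →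
        ∃ τ : Fin (curveGenus C) → AlgPoints C K, Function.Injective τ ∧ (∏ j, τ j ≫ 𝒥.abelJacobi P) = a ∧
          ∀ τ' : Fin (curveGenus C) → AlgPoints C K, (∏ j, τ' j ≫ 𝒥.abelJacobi P) = a →
            ∃ σ : Equiv.Perm (Fin (curveGenus C)), τ' = τ ∘ σ := by
  classical
  -- `g := curveGenus C` as an opaque natural number in the goal (`hpos`, `hC` keep `curveGenus C` for the ★ inputs)
  generalize hg : curveGenus C = g
  haveI : LocallyOfFiniteType 𝒥.J.X.hom := 𝒥.J.isProper.toLocallyOfFiniteType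
  haveI : JacobsonSpace (powC C g).left := LocallyOfFiniteType.jacobsonSpace (powC C g).hom
  have hX : CechPseudoCoherentAt C := cechPseudoCoherentAt_of_general cechComplex_pseudoCoherent_general_holds C
  -- the Abel-sum morphism `Φ = α_g` and the diagonal maps `δ (i, j)`, as opaque locals with their defining equations
  obtain ⟨Φ, hΦ⟩ : ∃ Φ : powC C g ⟶ 𝒥.J.X, Φ = 𝒥.abelSum P g := ⟨_, rfl⟩
  obtain ⟨δ, hδ⟩ : ∃ δ : Fin g × Fin g → (powC C g ⟶ powC C g),
      δ = fun p => liftOver C.hom g (fun l => coord C g (if l = p.2 then p.1 else l)) := ⟨_, rfl⟩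
  have hΦτ : ∀ τ : Fin g → AlgPoints C K,
      tuplePt C (strPt (K := K) K) τ ≫ Φ = ∏ j, τ j ≫ 𝒥.abelJacobi P := fun τ => by
    rw [hΦ]; exact 𝒥.liftOver_comp_abelSum P g τ
  have hΦω : ∀ ω : AlgPoints (powC C g) K, ω ≫ Φ = ∏ j, (ω ≫ coord C g j) ≫ 𝒥.abelJacobi P := fun ω => by
    rw [hΦ]; exact 𝒥.comp_abelSum_eq_prod P g ω
  have hδcoord : ∀ (i j l : Fin g),
      liftOver C.hom g (fun l => coord C g (if l = j then i else l)) ≫ coord C g l = coord C g (if l = j then i else l) :=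
    fun i j l => liftOver_projOver C.hom g _ l
  have hδfix : ∀ (τ : Fin g → AlgPoints C K) (i j : Fin g), τ i = τ j →
      tuplePt C (strPt (K := K) K) τ ≫ δ (i, j) = tuplePt C (strPt (K := K) K) τ := fun τ i j h => by
    rw [hδ]
    refine hom_ext_projOver C.hom g _ _ fun l => ?_
    change (tuplePt C _ τ ≫ liftOver C.hom g (fun l => coord C g (if l = j then i else l))) ≫ coord C g l =
      tuplePt C _ τ ≫ coord C g l
    rw [Category.assoc, hδcoord, tuplePt_coord, tuplePt_coord]
    by_cases hl : l = j
    · rw [if_pos hl, hl, h]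
    · rw [if_neg hl]
  have hδlift : ∀ (τ : Fin g → AlgPoints C K) (i j : Fin g),
      AlgPoints.pt (tuplePt C (strPt (K := K) K) τ) ∈ Set.range (δ (i, j)).left → τ i = τ j := fun τ i j h => by
    rw [hδ] at h; exact WeilJacobian.apply_eq_of_pt_mem_range_diagMap C g τ h
  -- properness: `Cᵍ` proper, `J` and `Cᵍ` separated ⇒ `Φ` and the `δ p` are closed maps
  haveI hP : IsProper (powC C g).hom := isProper_powOver_base C.hom g
  haveI : IsProper 𝒥.J.X.hom := 𝒥.J.isProper
  haveI : IsProper Φ.left := by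
    have h : IsProper (Φ.left ≫ 𝒥.J.X.hom) := by rw [Over.w Φ]; infer_instance
    exact IsProper.of_comp Φ.left 𝒥.J.X.hom
  have hδc : ∀ p : Fin g × Fin g, IsClosed (Set.range (δ p).left) := fun p => by
    have h : IsProper ((δ p).left ≫ (powC C g).hom) := by rw [Over.w (δ p)]; infer_instance
    haveI : IsProper (δ p).left := IsProper.of_comp (δ p).left (powC C g).hom
    exact (δ p).left.isClosedMap.isClosed_range
  -- the bad closed set `Z = (general locus)ᶜ ∪ ⋃_{i ≠ j} δ_{ij}(Cᵍ)` and the open `U = (Φ(Z))ᶜ`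
  obtain ⟨D, hD⟩ : ∃ D : Set (powC C g).left,
      D = ⋃ p : {p : Fin g × Fin g // p.1 ≠ p.2}, Set.range (δ p.1).left := ⟨_, rfl⟩
  have hDc : IsClosed D := by rw [hD]; exact isClosed_iUnion_of_finite fun p => hδc p.1
  obtain ⟨Z, hZ⟩ : ∃ Z : Set (powC C g).left, Z = (generalLocus C g)ᶜ ∪ D := ⟨_, rfl⟩
  have hZc : IsClosed Z := by rw [hZ]; exact (isOpen_generalLocus C g hX).isClosed_compl.union hDc
  have hUo : IsOpen (Φ.left '' Z)ᶜ := (Φ.left.isClosedMap Z hZc).isOpen_compl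
  -- K-points of `Cᵍ` outside `Z`: distinct coordinates with `ℓ = 1`
  have hgood : ∀ ω : AlgPoints (powC C g) K, ω.pt ∉ Z →
      Function.Injective (fun j => ω ≫ coord C g j) ∧ ell (tupleDiv C fun j => ω ≫ coord C g j) = 1 := by
    intro ω hω
    rw [hZ, Set.mem_union, not_or, Set.mem_compl_iff, not_not] at hω
    refine ⟨fun i j hij => ?_, (WeilJacobian.pt_mem_generalLocus_iff C g ω).mp hω.1⟩
    by_contra hne
    apply hω.2
    rw [hD, Set.mem_iUnion]
    refine ⟨⟨(i, j), hne⟩, ω.pt, ?_⟩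
    have hfix := hδfix (fun l => ω ≫ coord C g l) i j hij
    rw [tuplePt_comp_coord] at hfix
    conv_rhs => rw [← hfix]
    exact (AlgPoints.pt_comp (δ (i, j)) ω).symm
  -- conversely, good tuples lie outside `Z`
  have hgood' : ∀ τ : Fin g → AlgPoints C K, Function.Injective τ → ell (tupleDiv C τ) = 1 →
      AlgPoints.pt (tuplePt C (strPt (K := K) K) τ) ∉ Z := by
    intro τ hinj hℓ hmem
    rw [hZ, Set.mem_union, Set.mem_compl_iff, hD, Set.mem_iUnion] at hmem
    rcases hmem with hgen | ⟨⟨⟨i, j⟩, hij⟩, hr⟩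
    · apply hgen
      rw [WeilJacobian.pt_mem_generalLocus_iff C g]
      simpa only [tuplePt_coord] using hℓ
    · exact hij (hinj (hδlift τ i j hr))
  refine ⟨⟨(Φ.left '' Z)ᶜ, hUo⟩, ?_, fun a ha => ?_⟩
  · -- NON-EMPTINESS
    -- (1) the good locus `Zᶜ` is a non-empty open of the irreducible `Cᵍ`
    have hVne : (Zᶜ : Set (powC C g).left).Nonempty := by
      rw [hZ, Set.compl_union, compl_compl, hD, Set.compl_iUnion]
      have hgen : (generalLocus C g).Nonempty := nonempty_generalLocus_of_le C hg.ge
      -- a finite intersection of non-empty opens in the irreducible `Cᵍ` is non-empty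
      have hstep : ∀ S : Finset {p : Fin g × Fin g // p.1 ≠ p.2},
          (generalLocus C g ∩ ⋂ p ∈ S, (Set.range (δ p.1).left)ᶜ).Nonempty := by
        intro S
        induction S using Finset.induction_on with
        | empty => simpa using hgen
        | insert p S hp ih =>
          rw [Finset.set_biInter_insert, Set.inter_left_comm]
          -- two distinct points of `C` give a tuple off the diagonal `δ_p`
          have hne : ((Set.range (δ p.1).left)ᶜ).Nonempty := by
            haveI := infinite_algPoints C (K := K)
            obtain ⟨Q₁, Q₂, hQ⟩ := exists_pair_ne (AlgPoints C K)
            refine ⟨AlgPoints.pt (tuplePt C (strPt (K := K) K) fun l => if l = p.1.1 then Q₁ else Q₂), fun hr => hQ ?_⟩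
            have h := hδlift (fun l => if l = p.1.1 then Q₁ else Q₂) p.1.1 p.1.2 hr
            simp only [if_neg (Ne.symm p.2)] at h
            exact h
          exact nonempty_preirreducible_inter (hδc p.1).isOpen_compl
            ((isOpen_generalLocus C g hX).inter (isOpen_biInter_finset fun q _ => (hδc q.1).isOpen_compl)) hne ih
      simpa [Set.iInter_subtype] using hstep Finset.univ
    -- (2) a K-point `ω₀` in the good locus
    obtain ⟨ω₀, hω₀⟩ : ∃ ω : AlgPoints (powC C g) K, ω.pt ∈ Zᶜ := by
      by_contra hno
      push Not at hno
      exact hVne.ne_empty (eq_empty_of_isOpen_of_forall_pt_not_mem hZc.isOpen_compl hno)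
    obtain ⟨hinj₀, hℓ₀⟩ := hgood ω₀ hω₀
    -- (3) `Φ(ω₀) ∈ U`: a point of `Z` over `Φ(ω₀)` specialises to a CLOSED point of `Z` over it, i.e. a K-point, whose
    -- coordinates are a permutation of those of `ω₀` — but those are good
    refine ⟨AlgPoints.pt (ω₀ ≫ Φ), fun ⟨z, hzZ, hz⟩ => ?_⟩
    have hFc : IsClosed (Z ∩ Φ.left ⁻¹' {AlgPoints.pt (ω₀ ≫ Φ)}) :=
      hZc.inter (IsClosed.preimage Φ.left.continuous (AlgPoints.isClosed_singleton_pt (ω₀ ≫ Φ)))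
    obtain ⟨z', ⟨hz'Z, hz'F⟩, hz'c⟩ := nonempty_inter_closedPoints (Z := Z ∩ Φ.left ⁻¹' {AlgPoints.pt (ω₀ ≫ Φ)})
      ⟨z, hzZ, hz⟩ hFc.isLocallyClosed
    obtain ⟨ω, hω⟩ := AlgPoints.exists_pt_eq_of_isClosed_singleton (X := powC C g) (mem_closedPoints_iff.mp hz'c)
    have hωΦ : ω ≫ Φ = ω₀ ≫ Φ := by
      apply AlgPoints.eq_of_pt_eq
      rw [AlgPoints.pt_comp, hω]
      exact hz'F
    rw [hΦω, hΦω] at hωΦ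
    obtain ⟨σ, hσ⟩ := 𝒥.exists_perm_of_prod_comp_abelJacobi_eq_of_ell_eq_one hC hpos P _ hℓ₀ _ hωΦ
    have hωinj : Function.Injective (fun j => ω ≫ coord C g j) := by rw [hσ]; exact hinj₀.comp σ.injective
    have hωℓ : ell (tupleDiv C fun j => ω ≫ coord C g j) = 1 := by
      rw [hσ, tupleDiv_comp_perm]
      exact hℓ₀
    have hout := hgood' _ hωinj hωℓ
    rw [tuplePt_comp_coord] at hout
    exact hout (hω ▸ hz'Z)
  · -- THE PROPERTY: `a ∈ U(K)` is `α_g(τ)` for a good tuple (`α_g` is onto `J(K)` because `W̃_g(P) = J`)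
    obtain ⟨τ, hτ⟩ := 𝒥.exists_tuple_prod_comp_abelJacobi_eq_of_curveGenus_le hC P hpos hg.le a
    have hτpt : AlgPoints.pt (tuplePt C (strPt (K := K) K) τ) ∉ Z := by
      intro hmem
      apply ha
      refine ⟨_, hmem, ?_⟩
      rw [← AlgPoints.pt_comp, hΦτ, hτ]
    obtain ⟨hinj, hℓ⟩ := hgood _ hτpt
    simp only [tuplePt_coord] at hinj hℓ
    exact ⟨τ, hinj, hτ, fun τ' hτ' =>
      𝒥.exists_perm_of_prod_comp_abelJacobi_eq_of_ell_eq_one hC hpos P τ hℓ τ' (hτ'.trans hτ.symm)⟩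

end Jacobian

end Literature.AlgebraicGeometry.Motives

end
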